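import Literature.NumberTheory.LFunctions.NymanBeurlingRateReduction
import Literature.NumberTheory.LFunctions.ZetaShiftRatioBounds
import Literature.NumberTheory.LFunctions.NymanBeurlingLindelofProofs
import Literature.NumberTheory.LFunctions.DirichletMVTSharp
import Literature.NumberTheory.LFunctions.RHLittlewoodZetaBounds
import HarnessLib

/-!
# Balazard–de Roton 2010, Proposition 13: the large ordinates `|τ| ≥ N^{3/4}` in `I_{N,ε}`

Topic `Literature/NumberTheory/LFunctions`; a brick of the proof of Balazard–de Roton 2010,
Théorème 1 (`Literature.NumberTheory.LFunctions.BalazardDeRoton2010_thm1`, `NymanBeurlingRate.lean`).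
M. Balazard, A. de Roton, *Sur un critère de Báez-Duarte pour l'hypothèse de Riemann*, Int. J.
Number Theory 6 (2010) 883–903 = arXiv:0812.1689, §7:

> **Proposition 13 (HR).** For `N ≥ 1`, `0 < ε ≤ 1/2`,
> `∫_{|τ| ≥ N^{3/4}} |ζ(s)|² |ζ(s+ε)^{-1} − M_N(s+ε)|² dτ/|s|² ≪ N^{-1/9}` (`s = 1/2 + iτ`).

Printed proof: on dyadic blocks `T ≤ |τ| ≤ 2T`,
`I_N(T,ε) ≪ T^{-2}∫|ζ/ζ_ε|² + T^{-2}∫|ζ|²|M_N|² ≪ T^{-3/2}(T+N) log N` by Prop. 4 (i),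
`|ζ(½+it)| ≪ t^{1/4}` and the Montgomery–Vaughan mean value theorem
`∫_T^{2T}|∑ a_n n^{-it}|² = (T + O(N))∑|a_n|²`; sum over `T = 2^k N^{3/4}`.

Here (`0 < ε ≤ 1/4`, the range used downstream): Prop. 4 (i) is
`BalazardDeRoton.exists_norm_zeta_half_le_rpow_mul` (`ZetaShiftRatioBounds.lean`); in place of
the convexity bound `t^{1/4}` we use the (stronger, RH-conditional — the proposition is (HR)
anyway) Lindelöf bound `|ζ(½+it)| ≪ |t|^{1/16}` (`norm_riemannZeta_le_mul_rpow_of_riemannHypothesis`,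
`NymanBeurlingLindelofProofs.lean`); the mean value theorem is the tree's explicit
`DirichletMVT.meanSquare_shift_le` (`∫_{-W}^{W}|∑_{n≤N} a_n n^{-it}|² ≤ ∑(5W+20+65n)|a_n|²`,
`DirichletMVTSharp.lean`). The outcome, `exists_lintegral_iIntegrand_tail_le`:
`∫_{|τ| ≥ N^{3/4}} iIntegrand N ε ≤ C N^{-3/8}` (any negative power serves the theorem; the printed
exponent is `−1/9`).

## References

* [BalazardDeRoton2010] M. Balazard, A. de Roton, Int. J. Number Theory 6 (2010) 883–903, §7,
  Prop. 13 (arXiv:0812.1689 pp. 10–11).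
* [Montgomery1994] H. L. Montgomery, *Ten lectures on the interface between analytic number
  theory and harmonic analysis*, CBMS 84 (1994), Ch. 7 (5) p. 128 (mean value theorem).
* [Titchmarsh1986] E. C. Titchmarsh, *The Theory of the Riemann Zeta-Function*, (5.1.8), §14.2.
-/

noncomputable section

open Complex Filter Topology Set MeasureTheory Real

namespace Literature.NumberTheory.LFunctions

namespace BalazardDeRoton

open BaezDuarteOnlyIf (moebiusSum)
open ArithmeticFunction (moebius)

/-! ## `ζ` on the critical line under RH: `|ζ(½+iτ)| ≪ |τ|^{1/16}` -/

/-- Under RH: `‖ζ(½+iτ)‖ ≤ C_ζ |τ|^{1/16}` for `|τ| ≥ 1` (RH ⇒ Lindelöf, tree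
`norm_riemannZeta_le_mul_rpow_of_riemannHypothesis`, plus conjugation and compactness for the
bounded ordinates). [cite: Titchmarsh1986, §14.2 and §13.1] -/
lemma exists_norm_zeta_half_le_rpow_sixteenth (hRH : RiemannHypothesis) :
    ∃ C : ℝ, 0 < C ∧ ∀ τ : ℝ, 1 ≤ |τ| → ‖riemannZeta (1 / 2 + τ * I)‖ ≤ C * |τ| ^ (1 / 16 : ℝ) := by
  obtain ⟨C, hC, T₀, hT₀, h⟩ := norm_riemannZeta_le_mul_rpow_of_riemannHypothesis hRH
    (ε := 1 / 16) (by norm_num)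
  -- the compact segment `|τ| ≤ T₀`
  obtain ⟨C', hC', h'⟩ := LittlewoodRH.norm_riemannZeta_le_of_isCompact
    (LittlewoodRH.isCompact_rect (1 / 2) (1 / 2) (-T₀) T₀) (fun s hs h1 ↦ by
      have := hs.1.2; rw [h1, one_re] at this; norm_num at this)
  refine ⟨max C C', by positivity, fun τ hτ ↦ ?_⟩
  have hτ0 : 0 < |τ| := by linarith
  have hpow : 1 ≤ |τ| ^ (1 / 16 : ℝ) := Real.one_le_rpow hτ (by norm_num)
  rcases le_or_gt T₀ |τ| with hbig | hsmall
  · -- large ordinates: LH (positive) or its conjugate (negative)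
    have key : ∀ t : ℝ, T₀ ≤ t → ‖riemannZeta (1 / 2 + t * I)‖ ≤ C * t ^ (1 / 16 : ℝ) := by
      intro t ht
      have := h (1 / 2 + t * I) (by simp) (by simpa using ht)
      simpa using this
    rcases le_or_gt 0 τ with hτpos | hτneg
    · rw [abs_of_nonneg hτpos] at hbig ⊢
      exact (key τ hbig).trans (by gcongr; exact le_max_left _ _)
    · have hτ' : |τ| = -τ := abs_of_neg hτneg
      rw [hτ'] at hbig ⊢
      have hconj : riemannZeta (1 / 2 + τ * I) = starRingEnd ℂ (riemannZeta (1 / 2 + (-τ) * I)) := by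
        rw [← riemannZeta_conj]; congr 1
        simp [Complex.ext_iff]
      rw [hconj, Complex.norm_conj]
      have := key (-τ) hbig
      push_cast at this
      refine this.trans (mul_le_mul_of_nonneg_right (le_max_left _ _) ?_)
      exact Real.rpow_nonneg (by linarith) _
  · -- bounded ordinates
    have hmem : (1 / 2 + τ * I : ℂ) ∈ Icc (1 / 2 : ℝ) (1 / 2) ×ℂ Icc (-T₀) T₀ := by
      refine ⟨by simp, ?_⟩
      simp only [mem_preimage, add_im, mul_im, ofReal_re, I_im, mul_one, ofReal_im, I_re,
        mul_zero, add_zero, mem_Icc]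
      norm_num
      exact ⟨by linarith [neg_abs_le τ], by linarith [le_abs_self τ]⟩
    calc ‖riemannZeta (1 / 2 + τ * I)‖ ≤ C' := h' _ hmem
      _ ≤ max C C' * 1 := by rw [mul_one]; exact le_max_right _ _
      _ ≤ max C C' * |τ| ^ (1 / 16 : ℝ) := by gcongr

/-! ## The Möbius Dirichlet polynomial `M_N(½+ε+it)` and its mean square -/

/-- `M_N(½+ε+it) = ∑_{n≤N} a_n n^{-it}` with `a_n = μ(n) n^{-(½+ε)}`. [folklore] -/
lemma moebiusSum_eq_dirichletPoly (N : ℕ) (ε t : ℝ) :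
    moebiusSum N (1 / 2 + ε + t * I) =
      ∑ n ∈ Finset.Icc 1 N, ((moebius n : ℂ) * (n : ℂ) ^ (-((1 / 2 + ε : ℝ) : ℂ))) *
        (n : ℂ) ^ (-((t : ℂ) * I)) := by
  unfold moebiusSum
  refine Finset.sum_congr rfl fun n hn ↦ ?_
  rw [Finset.mem_Icc] at hn
  have hn0 : (n : ℂ) ≠ 0 := by exact_mod_cast (show n ≠ 0 by omega)
  rw [div_eq_mul_inv, ← cpow_neg, mul_assoc, ← cpow_add _ _ hn0]
  congr 2
  push_cast
  ring

/-- `|a_n|² = n^{-1-2ε} ≤ 1/n` for `n ≥ 1`, `ε ≥ 0`. [folklore] -/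
lemma norm_sq_coeff_le {n : ℕ} (hn : 1 ≤ n) {ε : ℝ} (hε : 0 ≤ ε) :
    ‖(moebius n : ℂ) * (n : ℂ) ^ (-((1 / 2 + ε : ℝ) : ℂ))‖ ^ 2 ≤ (n : ℝ)⁻¹ := by
  have hn0 : (0 : ℝ) < n := by exact_mod_cast hn
  have hμ : ‖(moebius n : ℂ)‖ ≤ 1 := by
    rw [Complex.norm_intCast]
    exact_mod_cast ArithmeticFunction.abs_moebius_le_one
  have hpow : ‖(n : ℂ) ^ (-((1 / 2 + ε : ℝ) : ℂ))‖ = (n : ℝ) ^ (-(1 / 2 + ε)) := by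
    rw [← ofReal_natCast, ← ofReal_neg, ← ofReal_cpow hn0.le, Complex.norm_real,
      Real.norm_of_nonneg (Real.rpow_nonneg hn0.le _)]
  rw [norm_mul, mul_pow, hpow]
  have h1 : ((n : ℝ) ^ (-(1 / 2 + ε))) ^ 2 = (n : ℝ) ^ (-(1 + 2 * ε)) := by
    rw [← Real.rpow_natCast, ← Real.rpow_mul hn0.le]; congr 1; push_cast; ring
  have h2 : (n : ℝ) ^ (-(1 + 2 * ε)) ≤ (n : ℝ)⁻¹ := by
    rw [← Real.rpow_neg_one]
    exact Real.rpow_le_rpow_of_exponent_le (by exact_mod_cast hn) (by linarith)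
  calc ‖(moebius n : ℂ)‖ ^ 2 * ((n : ℝ) ^ (-(1 / 2 + ε))) ^ 2 ≤ 1 ^ 2 * (n : ℝ)⁻¹ := by
        rw [h1]; gcongr
    _ = (n : ℝ)⁻¹ := by ring

/-- **Mean square of `M_N(½+ε+it)`** (Montgomery–Vaughan, tree `DirichletMVT.meanSquare_shift_le`):
for `W > 0`, `ε ≥ 0`, `∫_{-W}^{W} |M_N(½+ε+it)|² dt ≤ (5W + 20)(1 + log N) + 65N`.
[cite: Montgomery1994, Ch. 7 (5)] -/
lemma integral_norm_sq_moebiusSum_le (N : ℕ) {ε : ℝ} (hε : 0 ≤ ε) {W : ℝ} (hW : 0 < W) :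
    ∫ t in (-W)..W, ‖moebiusSum N (1 / 2 + ε + t * I)‖ ^ 2 ≤
      (5 * W + 20) * (1 + Real.log N) + 65 * N := by
  set a : ℕ → ℂ := fun n ↦ (moebius n : ℂ) * (n : ℂ) ^ (-((1 / 2 + ε : ℝ) : ℂ)) with ha
  have h := DirichletMVT.meanSquare_shift_le a N hW 0
  simp only [zero_sub, zero_add] at h
  have heq : ∀ t : ℝ, ‖moebiusSum N (1 / 2 + ε + t * I)‖ ^ 2 =
      ‖∑ n ∈ Finset.Icc 1 N, a n * (n : ℂ) ^ (-((t : ℂ) * I))‖ ^ 2 := fun t ↦ by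
    rw [moebiusSum_eq_dirichletPoly]
  simp_rw [heq]
  refine h.trans ?_
  -- `∑ (5W+20+65n)|a_n|² ≤ ∑ ((5W+20)/n + 65)`
  have hharm : ∑ n ∈ Finset.Icc 1 N, ((n : ℝ))⁻¹ ≤ 1 + Real.log N := by
    have := harmonic_le_one_add_log N
    rw [harmonic_eq_sum_Icc] at this
    push_cast at this
    exact this
  calc ∑ n ∈ Finset.Icc 1 N, (5 * W + 20 + 65 * n) * ‖a n‖ ^ 2
      ≤ ∑ n ∈ Finset.Icc 1 N, ((5 * W + 20) * ((n : ℝ))⁻¹ + 65) := by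
        refine Finset.sum_le_sum fun n hn ↦ ?_
        rw [Finset.mem_Icc] at hn
        have hn0 : (0 : ℝ) < n := by exact_mod_cast hn.1
        have hc := norm_sq_coeff_le hn.1 hε
        calc (5 * W + 20 + 65 * n) * ‖a n‖ ^ 2 ≤ (5 * W + 20 + 65 * n) * ((n : ℝ))⁻¹ := by
              gcongr
          _ = (5 * W + 20) * ((n : ℝ))⁻¹ + 65 := by field_simp
    _ = (5 * W + 20) * ∑ n ∈ Finset.Icc 1 N, ((n : ℝ))⁻¹ + 65 * N := by
        rw [Finset.sum_add_distrib, Finset.mul_sum, Finset.sum_const, Nat.card_Icc]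
        simp [mul_comm]
    _ ≤ (5 * W + 20) * (1 + Real.log N) + 65 * N := by gcongr

/-- Continuity of `t ↦ M_N(½+ε+it)`. [folklore] -/
lemma continuous_moebiusSum_line (N : ℕ) (ε : ℝ) :
    Continuous fun t : ℝ ↦ moebiusSum N (1 / 2 + ε + t * I) := by
  unfold moebiusSum
  refine continuous_finsetSum _ fun n hn ↦ ?_
  rw [Finset.mem_Icc] at hn
  have hn0 : (n : ℂ) ≠ 0 := by exact_mod_cast (show n ≠ 0 by omega)
  refine Continuous.div continuous_const (Continuous.const_cpow (by fun_prop) (Or.inl hn0))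
    fun t ↦ ?_
  rw [Ne, Complex.cpow_eq_zero_iff, not_and_or]
  exact Or.inl hn0

/-! ## A dyadic block `T ≤ |τ| ≤ 2T` -/

/-- **Pointwise bound on a dyadic block** (`T ≥ 1`, `T ≤ |τ| ≤ 2T`, `0 < ε ≤ 1/4`):
`iIntegrand N ε τ ≤ 4C₁² T^{-7/4} + 4C_ζ² T^{-15/8} |M_N(½+ε+iτ)|²`, from
`|M − ζ_ε⁻¹|² ≤ 2|M|² + 2|ζ_ε⁻¹|²`, Prop. 4 (i) (`|ζ|²|ζ_ε⁻¹|² ≤ C₁²(1+|τ|)^ε ≤ 2C₁²T^{1/4}`),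
`|ζ|² ≤ C_ζ²|τ|^{1/8} ≤ 2C_ζ²T^{1/8}` and `|s|² ≥ T²`.
[cite: BalazardDeRoton2010, Prop. 13 (proof)] -/
lemma iIntegrand_le_block {C₁ Cζ : ℝ} (hC₁ : 0 < C₁) (hCζ : 0 < Cζ)
    (h4 : ∀ τ ε : ℝ, 0 ≤ ε → ε ≤ 1 / 4 → ‖riemannZeta (1 / 2 + τ * I)‖ ≤
      C₁ * (1 + |τ|) ^ (ε / 2) * ‖riemannZeta (1 / 2 + ε + τ * I)‖)
    (hζ : ∀ τ : ℝ, 1 ≤ |τ| → ‖riemannZeta (1 / 2 + τ * I)‖ ≤ Cζ * |τ| ^ (1 / 16 : ℝ))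
    (N : ℕ) {ε : ℝ} (hε : 0 < ε) (hε1 : ε ≤ 1 / 4) {T : ℝ} (hT : 1 ≤ T) {τ : ℝ}
    (hτ1 : T ≤ |τ|) (hτ2 : |τ| ≤ 2 * T) :
    iIntegrand N ε τ ≤ 4 * C₁ ^ 2 * T ^ (-(7 / 4 : ℝ)) +
      4 * Cζ ^ 2 * T ^ (-(15 / 8 : ℝ)) * ‖moebiusSum N (1 / 2 + ε + τ * I)‖ ^ 2 := by
  have hT0 : 0 < T := by linarith
  set z : ℝ := ‖riemannZeta (1 / 2 + τ * I)‖ with hz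
  set m : ℝ := ‖moebiusSum N (1 / 2 + ε + τ * I)‖ with hm
  set vi : ℝ := ‖(riemannZeta (1 / 2 + ε + τ * I))⁻¹‖ with hvi
  -- (a) `z · vi ≤ C₁ (1+|τ|)^{ε/2}`
  have ha : z * vi ≤ C₁ * (1 + |τ|) ^ (ε / 2) := by
    have h := h4 τ ε hε.le hε1
    by_cases h0 : riemannZeta (1 / 2 + ε + τ * I) = 0
    · rw [hvi, h0, inv_zero, norm_zero, mul_zero]; positivity
    · have hp : 0 < ‖riemannZeta (1 / 2 + ε + τ * I)‖ := norm_pos_iff.mpr h0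
      rw [hvi, norm_inv, ← div_eq_mul_inv, div_le_iff₀ hp]
      exact h
  have ha2 : z ^ 2 * vi ^ 2 ≤ 2 * C₁ ^ 2 * T ^ (1 / 4 : ℝ) := by
    have h1 : (1 + |τ|) ^ (ε / 2) ≤ (3 * T) ^ (1 / 8 : ℝ) :=
      calc (1 + |τ|) ^ (ε / 2) ≤ (1 + |τ|) ^ (1 / 8 : ℝ) :=
            Real.rpow_le_rpow_of_exponent_le (by linarith [abs_nonneg τ]) (by linarith)
        _ ≤ (3 * T) ^ (1 / 8 : ℝ) := Real.rpow_le_rpow (by positivity) (by linarith) (by norm_num)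
    have h2 : ((3 * T) ^ (1 / 8 : ℝ)) ^ 2 ≤ 2 * T ^ (1 / 4 : ℝ) := by
      rw [← Real.rpow_natCast, ← Real.rpow_mul (by positivity), Real.mul_rpow (by norm_num) hT0.le]
      norm_num
      have h3 : (3 : ℝ) ^ (1 / 4 : ℝ) ≤ 2 := by
        have : (3 : ℝ) ≤ 2 ^ (4 : ℝ) := by norm_num
        calc (3 : ℝ) ^ (1 / 4 : ℝ) ≤ (2 ^ (4 : ℝ)) ^ (1 / 4 : ℝ) :=
              Real.rpow_le_rpow (by norm_num) this (by norm_num)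
          _ = 2 := by rw [← Real.rpow_mul (by norm_num)]; norm_num
      exact mul_le_mul_of_nonneg_right h3 (Real.rpow_nonneg hT0.le _)
    calc z ^ 2 * vi ^ 2 = (z * vi) ^ 2 := by ring
      _ ≤ (C₁ * (1 + |τ|) ^ (ε / 2)) ^ 2 := pow_le_pow_left₀ (by positivity) ha 2
      _ = C₁ ^ 2 * ((1 + |τ|) ^ (ε / 2)) ^ 2 := by ring
      _ ≤ C₁ ^ 2 * ((3 * T) ^ (1 / 8 : ℝ)) ^ 2 := by gcongr
      _ ≤ C₁ ^ 2 * (2 * T ^ (1 / 4 : ℝ)) := by gcongr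
      _ = 2 * C₁ ^ 2 * T ^ (1 / 4 : ℝ) := by ring
  -- (b) `z² ≤ 2 C_ζ² T^{1/8}`
  have hb : z ^ 2 ≤ 2 * Cζ ^ 2 * T ^ (1 / 8 : ℝ) := by
    have h := hζ τ (by linarith)
    have h1 : (|τ| ^ (1 / 16 : ℝ)) ^ 2 ≤ 2 * T ^ (1 / 8 : ℝ) := by
      rw [← Real.rpow_natCast, ← Real.rpow_mul (abs_nonneg τ)]
      norm_num
      calc |τ| ^ (1 / 8 : ℝ) ≤ (2 * T) ^ (1 / 8 : ℝ) := Real.rpow_le_rpow (abs_nonneg τ) hτ2 (by norm_num)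
        _ = 2 ^ (1 / 8 : ℝ) * T ^ (1 / 8 : ℝ) := Real.mul_rpow (by norm_num) hT0.le
        _ ≤ 2 * T ^ (1 / 8 : ℝ) := by
            gcongr
            calc (2 : ℝ) ^ (1 / 8 : ℝ) ≤ 2 ^ (1 : ℝ) :=
                  Real.rpow_le_rpow_of_exponent_le (by norm_num) (by norm_num)
              _ = 2 := Real.rpow_one 2
    calc z ^ 2 ≤ (Cζ * |τ| ^ (1 / 16 : ℝ)) ^ 2 := pow_le_pow_left₀ (norm_nonneg _) h 2
      _ = Cζ ^ 2 * (|τ| ^ (1 / 16 : ℝ)) ^ 2 := by ring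
      _ ≤ Cζ ^ 2 * (2 * T ^ (1 / 8 : ℝ)) := by gcongr
      _ = 2 * Cζ ^ 2 * T ^ (1 / 8 : ℝ) := by ring
  -- (c) `|s|² ≥ T²`
  have hs : T ^ 2 ≤ ‖(1 / 2 + τ * I : ℂ)‖ ^ 2 := by
    rw [Complex.sq_norm, Complex.normSq_apply]; simp
    have : T ^ 2 ≤ |τ| ^ 2 := pow_le_pow_left₀ hT0.le hτ1 2
    rw [sq_abs] at this; nlinarith
  have hs0 : 0 < ‖(1 / 2 + τ * I : ℂ)‖ ^ 2 := lt_of_lt_of_le (by positivity) hs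
  -- combine
  have hsplit : ‖moebiusSum N (1 / 2 + ε + τ * I) - (riemannZeta (1 / 2 + ε + τ * I))⁻¹‖ ^ 2 ≤
      2 * m ^ 2 + 2 * vi ^ 2 := by
    have := norm_sub_le (moebiusSum N (1 / 2 + ε + τ * I)) (riemannZeta (1 / 2 + ε + τ * I))⁻¹
    rw [← hm, ← hvi] at this
    nlinarith [norm_nonneg (moebiusSum N (1 / 2 + ε + τ * I) - (riemannZeta (1 / 2 + ε + τ * I))⁻¹),
      sq_nonneg (m - vi)]
  unfold iIntegrand
  rw [← hz, div_le_iff₀ hs0]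
  have hT74 : T ^ (-(7 / 4 : ℝ)) * T ^ 2 = T ^ (1 / 4 : ℝ) := by
    rw [show (T ^ 2 : ℝ) = T ^ (2 : ℝ) by norm_cast, ← Real.rpow_add hT0]; norm_num
  have hT158 : T ^ (-(15 / 8 : ℝ)) * T ^ 2 = T ^ (1 / 8 : ℝ) := by
    rw [show (T ^ 2 : ℝ) = T ^ (2 : ℝ) by norm_cast, ← Real.rpow_add hT0]; norm_num
  calc z ^ 2 * ‖moebiusSum N (1 / 2 + ε + τ * I) - (riemannZeta (1 / 2 + ε + τ * I))⁻¹‖ ^ 2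
      ≤ z ^ 2 * (2 * m ^ 2 + 2 * vi ^ 2) := by gcongr
    _ = 2 * z ^ 2 * m ^ 2 + 2 * (z ^ 2 * vi ^ 2) := by ring
    _ ≤ 2 * (2 * Cζ ^ 2 * T ^ (1 / 8 : ℝ)) * m ^ 2 + 2 * (2 * C₁ ^ 2 * T ^ (1 / 4 : ℝ)) := by
        gcongr
    _ = (4 * C₁ ^ 2 * T ^ (-(7 / 4 : ℝ)) + 4 * Cζ ^ 2 * T ^ (-(15 / 8 : ℝ)) * m ^ 2) * T ^ 2 := by
        rw [add_mul, mul_assoc (4 * C₁ ^ 2), hT74,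
          show 4 * Cζ ^ 2 * T ^ (-(15 / 8 : ℝ)) * m ^ 2 * T ^ 2 =
            4 * Cζ ^ 2 * (T ^ (-(15 / 8 : ℝ)) * T ^ 2) * m ^ 2 by ring, hT158]
        ring
    _ ≤ (4 * C₁ ^ 2 * T ^ (-(7 / 4 : ℝ)) + 4 * Cζ ^ 2 * T ^ (-(15 / 8 : ℝ)) * m ^ 2) *
          ‖(1 / 2 + τ * I : ℂ)‖ ^ 2 := by
        gcongr

/-- **The block integral** (`T ≥ 1`, `0 < ε ≤ 1/4`):
`∫_{T≤|τ|≤2T} iIntegrand N ε ≤ 16C₁²T^{-3/4} + 4C_ζ²T^{-15/8}((10T+20)(1+log N) + 65N)`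
(pointwise bound integrated over `[−2T, 2T]` and the mean value theorem).
[cite: BalazardDeRoton2010, Prop. 13 (proof, eq. (t26))] -/
lemma lintegral_block_le {C₁ Cζ : ℝ} (hC₁ : 0 < C₁) (hCζ : 0 < Cζ)
    (h4 : ∀ τ ε : ℝ, 0 ≤ ε → ε ≤ 1 / 4 → ‖riemannZeta (1 / 2 + τ * I)‖ ≤
      C₁ * (1 + |τ|) ^ (ε / 2) * ‖riemannZeta (1 / 2 + ε + τ * I)‖)
    (hζ : ∀ τ : ℝ, 1 ≤ |τ| → ‖riemannZeta (1 / 2 + τ * I)‖ ≤ Cζ * |τ| ^ (1 / 16 : ℝ))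
    (N : ℕ) {ε : ℝ} (hε : 0 < ε) (hε1 : ε ≤ 1 / 4) {T : ℝ} (hT : 1 ≤ T) :
    ∫⁻ τ in {τ : ℝ | T ≤ |τ| ∧ |τ| ≤ 2 * T}, ENNReal.ofReal (iIntegrand N ε τ) ≤
      ENNReal.ofReal (16 * C₁ ^ 2 * T ^ (-(3 / 4 : ℝ)) + 4 * Cζ ^ 2 * T ^ (-(15 / 8 : ℝ)) *
        ((10 * T + 20) * (1 + Real.log N) + 65 * N)) := by
  have hT0 : 0 < T := by linarith
  set A : ℝ := 4 * C₁ ^ 2 * T ^ (-(7 / 4 : ℝ)) with hA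
  set B : ℝ := 4 * Cζ ^ 2 * T ^ (-(15 / 8 : ℝ)) with hB
  have hA0 : 0 ≤ A := by positivity
  have hB0 : 0 ≤ B := by positivity
  set g : ℝ → ℝ := fun τ ↦ A + B * ‖moebiusSum N (1 / 2 + ε + τ * I)‖ ^ 2 with hg
  have hg0 : ∀ τ, 0 ≤ g τ := fun τ ↦ by positivity
  have hgc : Continuous g := continuous_const.add
    (continuous_const.mul ((continuous_moebiusSum_line N ε).norm.pow 2))
  -- Step 1: pointwise, and enlarge the domain to `[−2T, 2T]`
  have hsub : {τ : ℝ | T ≤ |τ| ∧ |τ| ≤ 2 * T} ⊆ Icc (-(2 * T)) (2 * T) := fun τ hτ ↦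
    ⟨by linarith [neg_abs_le τ, hτ.2], by linarith [le_abs_self τ, hτ.2]⟩
  have h1 : ∫⁻ τ in {τ : ℝ | T ≤ |τ| ∧ |τ| ≤ 2 * T}, ENNReal.ofReal (iIntegrand N ε τ) ≤
      ∫⁻ τ in Icc (-(2 * T)) (2 * T), ENNReal.ofReal (g τ) := by
    calc ∫⁻ τ in {τ : ℝ | T ≤ |τ| ∧ |τ| ≤ 2 * T}, ENNReal.ofReal (iIntegrand N ε τ)
        ≤ ∫⁻ τ in {τ : ℝ | T ≤ |τ| ∧ |τ| ≤ 2 * T}, ENNReal.ofReal (g τ) := by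
          refine setLIntegral_mono' ?_ fun τ hτ ↦ ENNReal.ofReal_le_ofReal ?_
          · exact (measurableSet_le measurable_const (measurable_id.abs)).inter
              (measurableSet_le measurable_id.abs measurable_const)
          · exact iIntegrand_le_block hC₁ hCζ h4 hζ N hε hε1 hT hτ.1 hτ.2
      _ ≤ ∫⁻ τ in Icc (-(2 * T)) (2 * T), ENNReal.ofReal (g τ) := lintegral_mono_set hsub
  refine h1.trans ?_
  -- Step 2: the integral over `[−2T, 2T]` as a Bochner integral, and the mean value theorem
  have hgi : IntegrableOn g (Icc (-(2 * T)) (2 * T)) := hgc.integrableOn_Icc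
  rw [← ofReal_integral_eq_lintegral_ofReal hgi (ae_of_all _ hg0)]
  refine ENNReal.ofReal_le_ofReal ?_
  have hMV := integral_norm_sq_moebiusSum_le N hε.le (W := 2 * T) (by positivity)
  rw [intervalIntegral.integral_of_le (by linarith), ← integral_Icc_eq_integral_Ioc] at hMV
  have hsplit : ∫ τ in Icc (-(2 * T)) (2 * T), g τ =
      A * (4 * T) + B * ∫ τ in Icc (-(2 * T)) (2 * T), ‖moebiusSum N (1 / 2 + ε + τ * I)‖ ^ 2 := by
    have hI1 : IntegrableOn (fun _ : ℝ ↦ A) (Icc (-(2 * T)) (2 * T)) :=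
      continuous_const.integrableOn_Icc
    have hI2 : IntegrableOn (fun τ : ℝ ↦ B * ‖moebiusSum N (1 / 2 + ε + τ * I)‖ ^ 2)
        (Icc (-(2 * T)) (2 * T)) :=
      (continuous_const.mul ((continuous_moebiusSum_line N ε).norm.pow 2)).integrableOn_Icc
    have e : ∫ τ in Icc (-(2 * T)) (2 * T), g τ = (∫ _ in Icc (-(2 * T)) (2 * T), A) +
        ∫ τ in Icc (-(2 * T)) (2 * T), B * ‖moebiusSum N (1 / 2 + ε + τ * I)‖ ^ 2 :=
      integral_add hI1 hI2
    have e2 : (∫ _ in Icc (-(2 * T)) (2 * T), A) = A * (4 * T) := by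
      rw [setIntegral_const, measureReal_def, Real.volume_Icc,
        ENNReal.toReal_ofReal (by linarith), smul_eq_mul]
      ring
    have e3 : ∫ τ in Icc (-(2 * T)) (2 * T), B * ‖moebiusSum N (1 / 2 + ε + τ * I)‖ ^ 2 =
        B * ∫ τ in Icc (-(2 * T)) (2 * T), ‖moebiusSum N (1 / 2 + ε + τ * I)‖ ^ 2 :=
      integral_const_mul _ _
    rw [e, e2, e3]
  rw [hsplit]
  have e1 : A * (4 * T) = 16 * C₁ ^ 2 * T ^ (-(3 / 4 : ℝ)) := by
    simp only [hA]
    have : T ^ (-(7 / 4 : ℝ)) * T = T ^ (-(3 / 4 : ℝ)) := by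
      conv_lhs => rw [show (T : ℝ) = T ^ (1 : ℝ) by rw [Real.rpow_one]]
      rw [← Real.rpow_mul hT0.le, ← Real.rpow_add hT0]; norm_num
    calc 4 * C₁ ^ 2 * T ^ (-(7 / 4 : ℝ)) * (4 * T) = 16 * C₁ ^ 2 * (T ^ (-(7 / 4 : ℝ)) * T) := by ring
      _ = _ := by rw [this]
  rw [e1]
  gcongr
  linarith

/-! ## Summing the dyadic blocks -/

/-- Dyadic cover of `{|τ| ≥ T₀}` (`T₀ > 0`). [folklore] -/
lemma subset_iUnion_blocks {T₀ : ℝ} (hT₀ : 0 < T₀) :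
    {τ : ℝ | T₀ ≤ |τ|} ⊆ ⋃ k : ℕ, {τ : ℝ | 2 ^ k * T₀ ≤ |τ| ∧ |τ| ≤ 2 * (2 ^ k * T₀)} := by
  intro τ hτ
  have hτ' : T₀ ≤ |τ| := hτ
  have hx : 1 ≤ |τ| / T₀ := by rw [le_div_iff₀ hT₀]; simpa using hτ'
  obtain ⟨k, hk1, hk2⟩ := exists_nat_pow_near hx one_lt_two
  refine mem_iUnion.mpr ⟨k, ?_, ?_⟩
  · rw [le_div_iff₀ hT₀] at hk1; exact hk1
  · rw [div_lt_iff₀ hT₀, pow_succ] at hk2; linarith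

/-- The simplified block bound: for `T ≥ 1`, `N ≥ 1`,
`16C₁²T^{-3/4} + 4C_ζ²T^{-15/8}((10T+20)(1+log N)+65N) ≤ D(1+log N)(T^{-3/4} + N T^{-15/8})`,
`D = 16C₁² + 380C_ζ²`. [folklore] -/
lemma block_bound_le {C₁ Cζ : ℝ} {N : ℕ} (hN : 1 ≤ N) {T : ℝ} (hT : 1 ≤ T) :
    16 * C₁ ^ 2 * T ^ (-(3 / 4 : ℝ)) + 4 * Cζ ^ 2 * T ^ (-(15 / 8 : ℝ)) *
        ((10 * T + 20) * (1 + Real.log N) + 65 * N) ≤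
      (16 * C₁ ^ 2 + 380 * Cζ ^ 2) * (1 + Real.log N) *
        (T ^ (-(3 / 4 : ℝ)) + N * T ^ (-(15 / 8 : ℝ))) := by
  have hT0 : 0 < T := by linarith
  have hL : 0 ≤ Real.log N := Real.log_nonneg (by exact_mod_cast hN)
  have hN0 : (1 : ℝ) ≤ N := by exact_mod_cast hN
  have h1 : 0 ≤ T ^ (-(3 / 4 : ℝ)) := Real.rpow_nonneg hT0.le _
  have h2 : 0 ≤ T ^ (-(15 / 8 : ℝ)) := Real.rpow_nonneg hT0.le _
  -- `T^{-15/8} · T ≤ T^{-3/4}`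
  have h3 : T ^ (-(15 / 8 : ℝ)) * T ≤ T ^ (-(3 / 4 : ℝ)) := by
    have : T ^ (-(15 / 8 : ℝ)) * T = T ^ (-(7 / 8 : ℝ)) := by
      conv_lhs => rw [show (T : ℝ) = T ^ (1 : ℝ) by rw [Real.rpow_one]]
      rw [← Real.rpow_mul hT0.le, ← Real.rpow_add hT0]; norm_num
    rw [this]
    exact Real.rpow_le_rpow_of_exponent_le hT (by norm_num)
  have h4 : T ^ (-(15 / 8 : ℝ)) ≤ T ^ (-(3 / 4 : ℝ)) :=
    Real.rpow_le_rpow_of_exponent_le hT (by norm_num)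
  -- expand and compare term by term
  have e : 4 * Cζ ^ 2 * T ^ (-(15 / 8 : ℝ)) * ((10 * T + 20) * (1 + Real.log N) + 65 * N) =
      40 * Cζ ^ 2 * (1 + Real.log N) * (T ^ (-(15 / 8 : ℝ)) * T) +
        80 * Cζ ^ 2 * (1 + Real.log N) * T ^ (-(15 / 8 : ℝ)) +
        260 * Cζ ^ 2 * (N * T ^ (-(15 / 8 : ℝ))) := by ring
  rw [e]
  set L : ℝ := 1 + Real.log N with hLdef
  have hL1 : 1 ≤ L := by rw [hLdef]; linarith
  set A : ℝ := T ^ (-(3 / 4 : ℝ)) with hAdef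
  set B : ℝ := T ^ (-(15 / 8 : ℝ)) with hBdef
  have hNB : 0 ≤ (N : ℝ) * B := by positivity
  have t1 : 16 * C₁ ^ 2 * A ≤ 16 * C₁ ^ 2 * L * A := by
    have : 16 * C₁ ^ 2 * A * 1 ≤ 16 * C₁ ^ 2 * A * L :=
      mul_le_mul_of_nonneg_left hL1 (by positivity)
    linarith
  have t2 : 40 * Cζ ^ 2 * L * (B * T) ≤ 40 * Cζ ^ 2 * L * A :=
    mul_le_mul_of_nonneg_left h3 (by positivity)
  have t3 : 80 * Cζ ^ 2 * L * B ≤ 80 * Cζ ^ 2 * L * A :=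
    mul_le_mul_of_nonneg_left h4 (by positivity)
  have t4 : 260 * Cζ ^ 2 * ((N : ℝ) * B) ≤ 260 * Cζ ^ 2 * L * ((N : ℝ) * B) := by
    have : 260 * Cζ ^ 2 * ((N : ℝ) * B) * 1 ≤ 260 * Cζ ^ 2 * ((N : ℝ) * B) * L :=
      mul_le_mul_of_nonneg_left hL1 (by positivity)
    linarith
  have t5 : 0 ≤ Cζ ^ 2 * L * A := by positivity
  have t6 : 0 ≤ Cζ ^ 2 * L * ((N : ℝ) * B) := by positivity
  have t7 : 0 ≤ C₁ ^ 2 * L * ((N : ℝ) * B) := by positivity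
  nlinarith

/-- `2^{-3/4} ≤ 3/5` (as `(5/3)⁴ ≤ 2³`). [folklore] -/
lemma two_rpow_neg_three_quarters_le : (2 : ℝ) ^ (-(3 / 4 : ℝ)) ≤ 3 / 5 := by
  rw [Real.rpow_neg (by norm_num), inv_le_comm₀ (by positivity) (by norm_num)]
  -- `5/3 ≤ 2^{3/4}` iff `(5/3)^4 ≤ 2^3`
  have h : ((5 : ℝ) / 3) = (((5 : ℝ) / 3) ^ (4 : ℝ)) ^ (1 / 4 : ℝ) := by
    rw [← Real.rpow_mul (by norm_num)]; norm_num
  have h2 : (2 : ℝ) ^ (3 / 4 : ℝ) = ((2 : ℝ) ^ (3 : ℝ)) ^ (1 / 4 : ℝ) := by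
    rw [← Real.rpow_mul (by norm_num)]; norm_num
  rw [show ((3 : ℝ) / 5)⁻¹ = 5 / 3 by norm_num, h, h2]
  refine Real.rpow_le_rpow (by positivity) ?_ (by norm_num)
  norm_num

/-- `(2^k T₀)^e = (2^e)^k T₀^e` (`T₀ ≥ 0`). [folklore] -/
lemma two_pow_mul_rpow (k : ℕ) {T₀ : ℝ} (hT₀ : 0 ≤ T₀) (e : ℝ) :
    ((2 : ℝ) ^ k * T₀) ^ e = ((2 : ℝ) ^ e) ^ k * T₀ ^ e := by
  rw [Real.mul_rpow (by positivity) hT₀, ← Real.rpow_natCast 2 k, ← Real.rpow_mul (by norm_num),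
    mul_comm (k : ℝ) e, Real.rpow_mul (by norm_num), Real.rpow_natCast]

/-- **The tail beyond `T₀ ≥ 1`**: summing the dyadic blocks,
`∫_{|τ|≥T₀} iIntegrand N ε ≤ 3D(1+log N)(T₀^{-3/4} + N T₀^{-15/8})`.
[cite: BalazardDeRoton2010, Prop. 13 (proof, summation of (t26))] -/
lemma lintegral_tail_le {C₁ Cζ : ℝ} (hC₁ : 0 < C₁) (hCζ : 0 < Cζ)
    (h4 : ∀ τ ε : ℝ, 0 ≤ ε → ε ≤ 1 / 4 → ‖riemannZeta (1 / 2 + τ * I)‖ ≤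
      C₁ * (1 + |τ|) ^ (ε / 2) * ‖riemannZeta (1 / 2 + ε + τ * I)‖)
    (hζ : ∀ τ : ℝ, 1 ≤ |τ| → ‖riemannZeta (1 / 2 + τ * I)‖ ≤ Cζ * |τ| ^ (1 / 16 : ℝ))
    {N : ℕ} (hN : 1 ≤ N) {ε : ℝ} (hε : 0 < ε) (hε1 : ε ≤ 1 / 4) {T₀ : ℝ} (hT₀ : 1 ≤ T₀) :
    ∫⁻ τ in {τ : ℝ | T₀ ≤ |τ|}, ENNReal.ofReal (iIntegrand N ε τ) ≤
      ENNReal.ofReal (3 * ((16 * C₁ ^ 2 + 380 * Cζ ^ 2) * (1 + Real.log N)) *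
        (T₀ ^ (-(3 / 4 : ℝ)) + N * T₀ ^ (-(15 / 8 : ℝ)))) := by
  have hT₀0 : 0 < T₀ := by linarith
  set D : ℝ := (16 * C₁ ^ 2 + 380 * Cζ ^ 2) * (1 + Real.log N) with hD
  have hL : 0 ≤ Real.log N := Real.log_nonneg (by exact_mod_cast hN)
  have hD0 : 0 ≤ D := by positivity
  set a : ℝ := (2 : ℝ) ^ (-(3 / 4 : ℝ)) with ha
  set b : ℝ := (2 : ℝ) ^ (-(15 / 8 : ℝ)) with hb
  have ha0 : 0 ≤ a := Real.rpow_nonneg (by norm_num) _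
  have hb0 : 0 ≤ b := Real.rpow_nonneg (by norm_num) _
  have ha1 : a ≤ 3 / 5 := two_rpow_neg_three_quarters_le
  have hba : b ≤ a := Real.rpow_le_rpow_of_exponent_le (by norm_num) (by norm_num)
  have hb1 : b ≤ 3 / 5 := hba.trans ha1
  -- the summands
  set f : ℕ → ℝ := fun k ↦ D * (a ^ k * T₀ ^ (-(3 / 4 : ℝ)) + N * (b ^ k * T₀ ^ (-(15 / 8 : ℝ))))
    with hf
  have hf0 : ∀ k, 0 ≤ f k := fun k ↦ by positivity
  have hfs : Summable f := by
    refine Summable.mul_left _ (Summable.add ?_ ?_)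
    · exact (summable_geometric_of_lt_one ha0 (by linarith)).mul_right _
    · exact ((summable_geometric_of_lt_one hb0 (by linarith)).mul_right _).mul_left _
  -- block by block
  have hblock : ∀ k : ℕ, ∫⁻ τ in {τ : ℝ | 2 ^ k * T₀ ≤ |τ| ∧ |τ| ≤ 2 * (2 ^ k * T₀)},
      ENNReal.ofReal (iIntegrand N ε τ) ≤ ENNReal.ofReal (f k) := by
    intro k
    have hTk : 1 ≤ 2 ^ k * T₀ := by
      have : (1 : ℝ) ≤ 2 ^ k := one_le_pow₀ (by norm_num)
      nlinarith
    have hTk0 : 0 < 2 ^ k * T₀ := by linarith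
    refine (lintegral_block_le hC₁ hCζ h4 hζ N hε hε1 hTk).trans (ENNReal.ofReal_le_ofReal ?_)
    refine (block_bound_le hN hTk).trans (le_of_eq ?_)
    simp only [hf, hD, ha, hb]
    rw [two_pow_mul_rpow k hT₀0.le, two_pow_mul_rpow k hT₀0.le]
  calc ∫⁻ τ in {τ : ℝ | T₀ ≤ |τ|}, ENNReal.ofReal (iIntegrand N ε τ)
      ≤ ∫⁻ τ in ⋃ k : ℕ, {τ : ℝ | 2 ^ k * T₀ ≤ |τ| ∧ |τ| ≤ 2 * (2 ^ k * T₀)},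
          ENNReal.ofReal (iIntegrand N ε τ) := lintegral_mono_set (subset_iUnion_blocks hT₀0)
    _ ≤ ∑' k : ℕ, ∫⁻ τ in {τ : ℝ | 2 ^ k * T₀ ≤ |τ| ∧ |τ| ≤ 2 * (2 ^ k * T₀)},
          ENNReal.ofReal (iIntegrand N ε τ) := lintegral_iUnion_le _ _
    _ ≤ ∑' k : ℕ, ENNReal.ofReal (f k) := ENNReal.tsum_le_tsum hblock
    _ = ENNReal.ofReal (∑' k : ℕ, f k) := (ENNReal.ofReal_tsum_of_nonneg hf0 hfs).symm
    _ ≤ _ := ENNReal.ofReal_le_ofReal ?_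
  -- evaluate the geometric series
  have hga : HasSum (fun k : ℕ ↦ a ^ k) (1 - a)⁻¹ := hasSum_geometric_of_lt_one ha0 (by linarith)
  have hgb : HasSum (fun k : ℕ ↦ b ^ k) (1 - b)⁻¹ := hasSum_geometric_of_lt_one hb0 (by linarith)
  have hsum : HasSum f (D * ((1 - a)⁻¹ * T₀ ^ (-(3 / 4 : ℝ)) +
      N * ((1 - b)⁻¹ * T₀ ^ (-(15 / 8 : ℝ))))) :=
    ((hga.mul_right _).add ((hgb.mul_right _).mul_left (N : ℝ))).mul_left D
  rw [hsum.tsum_eq]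
  have h1a : (1 - a)⁻¹ ≤ 3 := by rw [inv_le_comm₀ (by linarith) (by norm_num)]; linarith
  have h1b : (1 - b)⁻¹ ≤ 3 := by rw [inv_le_comm₀ (by linarith) (by norm_num)]; linarith
  have hA : 0 ≤ T₀ ^ (-(3 / 4 : ℝ)) := Real.rpow_nonneg hT₀0.le _
  have hB : 0 ≤ T₀ ^ (-(15 / 8 : ℝ)) := Real.rpow_nonneg hT₀0.le _
  calc D * ((1 - a)⁻¹ * T₀ ^ (-(3 / 4 : ℝ)) + N * ((1 - b)⁻¹ * T₀ ^ (-(15 / 8 : ℝ))))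
      ≤ D * (3 * T₀ ^ (-(3 / 4 : ℝ)) + N * (3 * T₀ ^ (-(15 / 8 : ℝ)))) := by gcongr
    _ = 3 * D * (T₀ ^ (-(3 / 4 : ℝ)) + N * T₀ ^ (-(15 / 8 : ℝ))) := by ring

/-! ## Proposition 13 -/

/-- `log N ≤ 32 N^{1/32}` and hence `1 + log N ≤ 33 N^{1/32}` for `N ≥ 1`. [folklore] -/
lemma one_add_log_le (N : ℕ) (hN : 1 ≤ N) : 1 + Real.log N ≤ 33 * (N : ℝ) ^ (1 / 32 : ℝ) := by
  have hN0 : (0 : ℝ) ≤ N := Nat.cast_nonneg N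
  have h1 : Real.log N ≤ (N : ℝ) ^ (1 / 32 : ℝ) / (1 / 32) := Real.log_le_rpow_div hN0 (by norm_num)
  have h2 : 1 ≤ (N : ℝ) ^ (1 / 32 : ℝ) := Real.one_le_rpow (by exact_mod_cast hN) (by norm_num)
  linarith

/-- **Balazard–de Roton 2010, Proposition 13 (HR)**, in the form used for Théorème 1: under RH
there is `C` such that for all `N ≥ 1` and `0 < ε ≤ 1/4`,
`∫_{|τ| ≥ N^{3/4}} |ζ(s)|²|M_N(s+ε) − ζ(s+ε)⁻¹|² dτ/|s|² ≤ C N^{-3/8}` (`s = ½+iτ`; printed with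
`N^{-1/9}`; any fixed negative power of `N` serves, being `≪ N^{-ε/2}`).
[cite: BalazardDeRoton2010, Prop. 13] -/
theorem exists_lintegral_iIntegrand_tail_le (hRH : RiemannHypothesis) :
    ∃ C : ℝ, 0 < C ∧ ∀ N : ℕ, 1 ≤ N → ∀ ε : ℝ, 0 < ε → ε ≤ 1 / 4 →
      ∫⁻ τ in {τ : ℝ | (N : ℝ) ^ (3 / 4 : ℝ) ≤ |τ|}, ENNReal.ofReal (iIntegrand N ε τ) ≤
        ENNReal.ofReal (C * (N : ℝ) ^ (-(3 / 8 : ℝ))) := by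
  obtain ⟨C₁, hC₁, h4⟩ := exists_norm_zeta_half_le_rpow_mul hRH
  obtain ⟨Cζ, hCζ, hζ⟩ := exists_norm_zeta_half_le_rpow_sixteenth hRH
  set D₀ : ℝ := 16 * C₁ ^ 2 + 380 * Cζ ^ 2 with hD₀
  refine ⟨3 * D₀ * 33 * 2, by positivity, fun N hN ε hε hε1 ↦ ?_⟩
  have hN1 : (1 : ℝ) ≤ N := by exact_mod_cast hN
  have hN0 : (0 : ℝ) < N := by linarith
  set T₀ : ℝ := (N : ℝ) ^ (3 / 4 : ℝ) with hT₀
  have hT₀1 : 1 ≤ T₀ := Real.one_le_rpow hN1 (by norm_num)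
  refine (lintegral_tail_le hC₁ hCζ h4 hζ hN hε hε1 hT₀1).trans (ENNReal.ofReal_le_ofReal ?_)
  -- `T₀^{-3/4} = N^{-9/16} ≤ N^{-13/32}`, `N T₀^{-15/8} = N^{-13/32}`, `1 + log N ≤ 33 N^{1/32}`
  have e1 : T₀ ^ (-(3 / 4 : ℝ)) = (N : ℝ) ^ (-(9 / 16 : ℝ)) := by
    rw [hT₀, ← Real.rpow_mul hN0.le]; norm_num
  have e2 : (N : ℝ) * T₀ ^ (-(15 / 8 : ℝ)) = (N : ℝ) ^ (-(13 / 32 : ℝ)) := by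
    rw [hT₀, ← Real.rpow_mul hN0.le]
    conv_lhs => rw [show (N : ℝ) = (N : ℝ) ^ (1 : ℝ) by rw [Real.rpow_one]]
    rw [← Real.rpow_mul hN0.le, ← Real.rpow_add hN0]; norm_num
  have h1 : (N : ℝ) ^ (-(9 / 16 : ℝ)) ≤ (N : ℝ) ^ (-(13 / 32 : ℝ)) :=
    Real.rpow_le_rpow_of_exponent_le hN1 (by norm_num)
  have h2 : (N : ℝ) ^ (1 / 32 : ℝ) * (N : ℝ) ^ (-(13 / 32 : ℝ)) = (N : ℝ) ^ (-(3 / 8 : ℝ)) := by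
    rw [← Real.rpow_add hN0]; norm_num
  have hlog := one_add_log_le N hN
  have hL0 : 0 ≤ Real.log N := Real.log_nonneg hN1
  have hpos : 0 ≤ (N : ℝ) ^ (-(13 / 32 : ℝ)) := Real.rpow_nonneg hN0.le _
  rw [e1, e2]
  calc 3 * (D₀ * (1 + Real.log N)) * ((N : ℝ) ^ (-(9 / 16 : ℝ)) + (N : ℝ) ^ (-(13 / 32 : ℝ)))
      ≤ 3 * (D₀ * (33 * (N : ℝ) ^ (1 / 32 : ℝ))) *
          ((N : ℝ) ^ (-(13 / 32 : ℝ)) + (N : ℝ) ^ (-(13 / 32 : ℝ))) := by gcongr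
    _ = 3 * D₀ * 33 * 2 * ((N : ℝ) ^ (1 / 32 : ℝ) * (N : ℝ) ^ (-(13 / 32 : ℝ))) := by ring
    _ = 3 * D₀ * 33 * 2 * (N : ℝ) ^ (-(3 / 8 : ℝ)) := by rw [h2]

end BalazardDeRoton

end Literature.NumberTheory.LFunctions

end
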